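import Mathlib.RepresentationTheory.Semisimple
import Literature.NumberTheory.EllipticCurves.TateModule
import Literature.NumberTheory.EllipticCurves.Isogeny
import HarnessLib

-- provenance: harness21/H21/H21/Statements/Hodge/FaltingsEC.lean @ c661e31 (interim HEAD d8f2665);
-- M5 mechanical rewrite
/-!
# Faltings' isogeny theorem and Tate's theorem: the elliptic-curve case

Family Hodge (group G16, outline `EllArithM`, item `HodgeFaltingsEC`); notions `tate_module`,
`cm_endomorphisms_isogeny`.

This file states the elliptic-curve special case of hodge.S27 (the Tate conjecture for
homomorphisms of abelian varieties: `Hom_K(A, B) ⊗ ℤ_ℓ → Hom_{Γ_K}(T_ℓ A, T_ℓ B)` is an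
isomorphism and `V_ℓ A` is a semisimple Galois module; proved by Tate over finite fields and by
Faltings over number fields). The general statement hodge.S27 concerns abelian varieties and stays
blocked on the trunk T-MOTIVE (`abelian_variety`); accordingly the declarations below carry **no**
inventory id and `statement_ids` is empty — this is a plain-text reference to hodge.S27 only.

## Contents

General part (base field `K`, prime `ℓ`):
* `Literature.AlgebraicGeometry.Motives.tateModule_map_smul`: `T_ℓ φ` of an isogeny `φ` is `Γ_K`-equivariant (proved; any
  Weierstrass curves).
* `Literature.Hodge.tateEndRingHom W ℓ : W.endRing →+* Module.End ℤ_[ℓ] (T_ℓ E)`: the ring map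
  `End_K(E) → End_{ℤ_ℓ}(T_ℓ E)`, `φ ↦ T_ℓ φ` (a real definition, any Weierstrass curve), and its
  equivariance.
* `Literature.AlgebraicGeometry.Motives.linearIndependent_tateModule_map`: for *elliptic* curves `E, E'` and `ℓ ≠ char K`,
  injectivity of `Hom_K(E, E') ⊗ ℤ_ℓ → Hom(T_ℓ E, T_ℓ E')`, phrased as: `ℤ`-linearly independent
  isogenies have `ℤ_ℓ`-linearly independent Tate-module maps (Silverman, *AEC*, III.7.4). The
  `IsElliptic` hypotheses are essential (for the cuspidal cubic `T_ℓ = 0`).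

Number-field part (Faltings 1983):
* `Literature.AlgebraicGeometry.Motives.mem_span_range_tateModule_map_of_equivariant`: surjectivity of
  `Hom_K(E, E') ⊗ ℤ_ℓ → Hom_{Γ_K}(T_ℓ E, T_ℓ E')` — every `Γ_K`-equivariant `ℤ_ℓ`-linear map
  `T_ℓ E → T_ℓ E'` lies in the `ℤ_ℓ`-span of the maps `T_ℓ φ`, `φ` an isogeny (Satz 4). Together
  with `linearIndependent_tateModule_map` this is exactly `Hom_K(E, E') ⊗ ℤ_ℓ ≅ Hom_{Γ_K}`.
* `Literature.AlgebraicGeometry.Motives.mem_span_range_tateEndRingHom_iff`: the literal `End` form,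
  `ℤ_ℓ · image(End_K(E)) = End_{Γ_K}(T_ℓ E)` inside `End_{ℤ_ℓ}(T_ℓ E)`.
* `Literature.AlgebraicGeometry.Motives.isIsogenous_iff_exists_tateModule_hom_ne_zero`: the corollary "isogenous iff there
  is a non-zero Tate homomorphism" (Faltings 1983, Korollar 2).
* `Literature.AlgebraicGeometry.Motives.isSemisimpleRepresentation_rationalGaloisRepTate`: `V_ℓ E` is a semisimple
  `ℚ_ℓ[Γ_K]`-module (Satz 3), via Mathlib's `Representation.IsSemisimpleRepresentation`.

Finite-field part (Tate 1966):
* `Literature.AlgebraicGeometry.Motives.mem_span_range_tateModule_map_of_equivariant_of_finite`,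
  `Literature.AlgebraicGeometry.Motives.mem_span_range_tateEndRingHom_iff_of_finite`: the first two
  statements over a finite field `k` (Tate 1966, Main Theorem), for `ℓ ≠ char k` (hypothesis
  `(hℓ : (ℓ : K) ≠ 0)`, essential here: for `ℓ = p` and `E` supersingular `T_p E = 0`).
* `Literature.AlgebraicGeometry.Motives.isSemisimpleRepresentation_rationalGaloisRepTate_of_finite`: semisimplicity of
  `V_ℓ E` over a finite field, for every prime `ℓ` (trivial when `ℓ = char k`).
* `Literature.AlgebraicGeometry.Motives.isIsogenous_iff_card_point_eq`: two elliptic curves over a finite field `k` are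
  isogenous over `k` iff `#E(k) = #E'(k)` (Tate 1966, Thm. 1(c)).
* `Literature.AlgebraicGeometry.Motives.isIsogenous_of_finite_iff_exists_tateModule_hom_ne_zero` (with the unfolding
  lemma `…_iff`): the third statement, Tate's isogeny criterion in Tate-module form — for
  `ℓ ≠ char k`, `E ~_k E'` iff there is a non-zero `Γ_k`-equivariant `T_ℓ E → T_ℓ E'`
  (Tate 1966, Main Theorem with Thm. 1(b)); body `(ℓ : K) ≠ 0 → (W.IsIsogenous W' ↔ ∃ f, …)`.

Deprecated record (verdict clean-up of 2026-08-15, final section; do not use):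
* `Literature.AlgebraicGeometry.Motives.isIsogenous_iff_exists_tateModule_hom_ne_zero_of_finite`: the
  first, **mis-parenthesised** rendering of the isogeny criterion (`(ℓ : K) ≠ 0 → A ↔ B` parses as
  `((ℓ : K) ≠ 0 → A) ↔ B`), false for `ℓ = char k` and formally **refuted** by
  `SupersingularF3.not_isIsogenous_iff_exists_tateModule_hom_ne_zero_of_finite`
  (module `Literature.AlgebraicGeometry.Motives.FaltingsECIsogenyFiniteProofs`); kept verbatim
  (D-0014; the refutation names it) under `@[deprecated]`, with the bridge `…_of_misstated`.

## Mathlib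

Mathlib has `Representation.IsSemisimpleRepresentation` (file
`Mathlib/RepresentationTheory/Semisimple.lean`, an `abbrev` for
`ComplementedLattice (Subrepresentation ρ)`, purely algebraic: no finiteness or continuity
hypothesis is required to *state* semisimplicity), `NumberField`, `Finite`, `Nat.card`,
`Submodule.span`, `LinearIndependent`, `Module.End`, `WeierstrassCurve.Affine.Point`; it has no
Tate modules, isogenies, or any form of the Tate/Faltings theorems (grep `Faltings`, `isogen` in
Mathlib: nothing relevant). Tate modules with their functoriality `Literature.NumberTheory.EllipticCurves.TateModule.map`, the Galois
representations `galoisRepTate`/`rationalGaloisRepTate`, and `Isogeny`, `IsIsogenous`, `endRing`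
come from the H21 preludes `EllArithM.TateModule` and `EllArithM.Isogeny`.

## Design choices

* `noncomputable section`; `namespace Literature.Hodge`; the base field lives in a named universe `u`
  (as in the preludes, where `geomPoints W : Type u`). `open scoped Classical` is not needed here
  (nothing uses decidability) and is omitted; `TranscendEllArithS.GaloisAction` is imported
  transitively through the two `EllArithM` preludes.
* `Hom_K(E, E')` is not bundled as a group in the prelude (an `Isogeny` has finite kernel, so `0`
  is excluded). The isomorphism `Hom_K(E, E') ⊗ ℤ_ℓ ≅ Hom_{Γ_K}(T_ℓ E, T_ℓ E')` is therefore
  split into its two halves, both stated inside `Hom_{ℤ_ℓ}(T_ℓ E, T_ℓ E')`: the image of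
  `Hom ⊗ ℤ_ℓ` is the `ℤ_ℓ`-span of `{T_ℓ φ | φ : Isogeny W W'}` (surjectivity = every equivariant
  map is in this span; injectivity = `ℤ`-independent isogenies stay `ℤ_ℓ`-independent, which for
  the torsion-free group `Hom_K(E, E')` is injectivity of `Hom ⊗ ℤ_ℓ → Hom(T_ℓ E, T_ℓ E')`).
  For `E = E'` the prelude's subring `W.endRing = End_K(E)` gives the literal ring map
  `tateEndRingHom`.
* Galois-equivariance of `f : T_ℓ E →ₗ[ℤ_ℓ] T_ℓ E'` is spelled with the componentwise action
  `σ • x` (`Literature.NumberTheory.EllipticCurves.TateModule.instDistribMulAction`), which is definitionally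
  `galoisRepTate W ℓ σ x` (`WeierstrassCurve.galoisRepTate_apply_apply`).
* No sorried structure theorem of the prelude (`Module.Finite`, `Module.Free`, continuity) is used
  as an instance or hypothesis: semisimplicity is stated for the bare representation.
* All target declarations are theorems in print, stated as named facts (`def … : Prop`, D-0014);
  the elementary API lemmas (`tateModule_map_smul`, the ring-map axioms of `tateEndRingHom`,
  the easy direction of equivariance) are proved. Each named fact quantifies its hypothesis
  instances (`[NumberField K]` / `[Finite K]`, `[W.IsElliptic]`, `[W'.IsElliptic]`) explicitly
  in its body: a `Prop`-valued `def` whose body does not use a section instance drops it, which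
  would state Faltings'/Tate's theorems for arbitrary fields and singular cubics (false: over
  `K = ℂ` non-isogenous curves have isomorphic Tate modules; for `y² = x³` one has `T_ℓ = 0`).

## References

* [Faltings1983Endlichkeit] G. Faltings, *Endlichkeitssätze für abelsche Varietäten über
  Zahlkörpern*, Invent. Math. 73 (1983), 349–366, Sätze 3–4 and Korollar 2.
* [Tate1966Endomorphisms] J. Tate, *Endomorphisms of abelian varieties over finite fields*,
  Invent. Math. 2 (1966), 134–144, Main Theorem, Theorem 1 and Theorem 2.
* [SilvermanAEC2009] J. H. Silverman, *The Arithmetic of Elliptic Curves*, GTM 106, 2nd ed.,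
  III.7.4, III.7.7, V.2, exercise 5.4.
-/

noncomputable section

universe u

namespace Literature.AlgebraicGeometry.Motives

open WeierstrassCurve

/-! ## Tate-module maps of isogenies and endomorphisms -/

section General

variable {K : Type u} [Field K] (W W' : WeierstrassCurve K) (ℓ : ℕ) [Fact ℓ.Prime]

variable {W W'} in
/-- The Tate-module map `T_ℓ φ : T_ℓ E →ₗ[ℤ_ℓ] T_ℓ E'` of an isogeny `φ : E → E'` defined over `K`
commutes with the absolute Galois group `Γ_K` (componentwise, from `Isogeny.equivariant`).
Silverman, *AEC*, III.7.4 and III.§7. [folklore] -/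
theorem tateModule_map_smul (φ : Isogeny W W') (σ : Field.absoluteGaloisGroup K)
    (x : W.tateModule ℓ) :
    Literature.NumberTheory.EllipticCurves.TateModule.map ℓ φ.toAddMonoidHom (σ • x) = σ • Literature.NumberTheory.EllipticCurves.TateModule.map ℓ φ.toAddMonoidHom x :=
  Literature.NumberTheory.EllipticCurves.TateModule.ext fun _ ↦ φ.equivariant σ _

/-- The ring homomorphism `End_K(E) → End_{ℤ_ℓ}(T_ℓ E)`, `φ ↦ T_ℓ φ`, from the `K`-rational
endomorphism ring `W.endRing` (a subring of `AddMonoid.End E(K̄)`) to the `ℤ_ℓ`-linear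
endomorphisms of the Tate module; this is the map whose `ℤ_ℓ`-linear extension
`End_K(E) ⊗ ℤ_ℓ → End_{Γ_K}(T_ℓ E)` is the subject of hodge.S27 (untagged special case).
Silverman, *AEC*, III.7.4; Tate, Invent. Math. 2 (1966), (1). [folklore] -/
def tateEndRingHom : W.endRing →+* Module.End ℤ_[ℓ] (W.tateModule ℓ) where
  toFun φ := Literature.NumberTheory.EllipticCurves.TateModule.map ℓ (φ.1 : W.geomPoints →+ W.geomPoints)
  map_one' := Literature.NumberTheory.EllipticCurves.TateModule.map_id
  map_mul' _ _ := Literature.NumberTheory.EllipticCurves.TateModule.map_comp _ _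
  map_zero' := LinearMap.ext fun _ ↦ Literature.NumberTheory.EllipticCurves.TateModule.ext fun _ ↦ rfl
  map_add' _ _ := LinearMap.ext fun _ ↦ Literature.NumberTheory.EllipticCurves.TateModule.ext fun _ ↦ rfl

/-- Unfolding `tateEndRingHom`: it is `TateModule.map` of the underlying group endomorphism.
[folklore] -/
@[simp]
theorem tateEndRingHom_apply (φ : W.endRing) :
    tateEndRingHom W ℓ φ = Literature.NumberTheory.EllipticCurves.TateModule.map ℓ (φ.1 : W.geomPoints →+ W.geomPoints) :=
  rfl

/-- The image of `End_K(E)` in `End_{ℤ_ℓ}(T_ℓ E)` consists of `Γ_K`-equivariant maps.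
Silverman, *AEC*, III.7.4. [folklore] -/
theorem tateEndRingHom_smul (φ : W.endRing) (σ : Field.absoluteGaloisGroup K)
    (x : W.tateModule ℓ) : tateEndRingHom W ℓ φ (σ • x) = σ • tateEndRingHom W ℓ φ x :=
  Literature.NumberTheory.EllipticCurves.TateModule.ext fun _ ↦ φ.2.2 σ _

/-- Every element of the `ℤ_ℓ`-span of the image of `End_K(E)` in `End_{ℤ_ℓ}(T_ℓ E)` is
`Γ_K`-equivariant (the easy inclusion `ℤ_ℓ · End_K(E) ⊆ End_{Γ_K}(T_ℓ E)`).
Silverman, *AEC*, III.7.4. [folklore] -/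
theorem smul_of_mem_span_range_tateEndRingHom {g : Module.End ℤ_[ℓ] (W.tateModule ℓ)}
    (hg : g ∈ Submodule.span ℤ_[ℓ] (Set.range (tateEndRingHom W ℓ)))
    (σ : Field.absoluteGaloisGroup K) (x : W.tateModule ℓ) : g (σ • x) = σ • g x := by
  induction hg using Submodule.span_induction generalizing x with
  | mem g hg =>
    obtain ⟨φ, rfl⟩ := hg
    exact tateEndRingHom_smul W ℓ φ σ x
  | zero => simp
  | add g g' _ _ hg hg' => simp [hg, hg']
  | smul c g _ hg => simp [hg, smul_comm]

variable {W W'} in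
/-- **Injectivity of `Hom_K(E, E') ⊗ ℤ_ℓ → Hom(T_ℓ E, T_ℓ E')`** for elliptic curves `E, E'`
over a field `K` and a prime `ℓ ≠ char K`: if the isogenies `φ i : E → E'` are `ℤ`-linearly
independent in the (torsion-free) group `Hom(E(K̄), E'(K̄))`, then their Tate-module maps
`T_ℓ (φ i)` are `ℤ_ℓ`-linearly independent.
Since `Hom_K(E, E')` is torsion-free, this is equivalent to injectivity of the natural map on
`Hom_K(E, E') ⊗ ℤ_ℓ`. Silverman, *AEC*, III.7.4; Tate, Invent. Math. 2 (1966), §1.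
[cite: SilvermanAEC2009, Thm. III.7.4] -/
def linearIndependent_tateModule_map : Prop :=
  ∀ [W.IsElliptic] [W'.IsElliptic], (ℓ : K) ≠ 0 → ∀ {ι : Type*} (φ : ι → Isogeny W W'),
    (LinearIndependent ℤ fun i ↦ (φ i).toAddMonoidHom) →
      LinearIndependent ℤ_[ℓ] fun i ↦ Literature.NumberTheory.EllipticCurves.TateModule.map ℓ (φ i).toAddMonoidHom

end General

/-! ## Faltings' theorems for elliptic curves over number fields -/

section NumberField

/- Hypothesis instances `[NumberField K] [W.IsElliptic] [W'.IsElliptic]` are quantified in each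
fact's body (see the module docstring, Design choices). -/
variable {K : Type u} [Field K] (W W' : WeierstrassCurve K) (ℓ : ℕ) [Fact ℓ.Prime]

variable {W W'} in
/-- Injectivity of `Hom_K(E, E') ⊗ ℤ_ℓ → Hom(T_ℓ E, T_ℓ E')` over a number field (no
restriction on `ℓ`, since `char K = 0`): `ℤ`-independent isogenies have `ℤ_ℓ`-independent
Tate-module maps. Silverman, *AEC*, III.7.4. [folklore] -/
def linearIndependent_tateModule_map_of_numberField : Prop :=
  ∀ [NumberField K] [W.IsElliptic] [W'.IsElliptic] {ι : Type*} (φ : ι → Isogeny W W'),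
    (LinearIndependent ℤ fun i ↦ (φ i).toAddMonoidHom) →
      LinearIndependent ℤ_[ℓ] fun i ↦ Literature.NumberTheory.EllipticCurves.TateModule.map ℓ (φ i).toAddMonoidHom

variable {W W'} in
/-- The number-field injectivity statement follows from the general one
(`linearIndependent_tateModule_map`, hypothesis `h`) since `char K = 0`. [folklore] -/
theorem linearIndependent_tateModule_map_of_numberField_of.{v}
    (h : linearIndependent_tateModule_map.{u, v} (W := W) (W' := W') ℓ) :
    linearIndependent_tateModule_map_of_numberField.{u, v} (W := W) (W' := W') ℓ :=
  fun φ hφ ↦ h (Nat.cast_ne_zero.mpr (Fact.out : ℓ.Prime).ne_zero) φ hφ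

/-- **Faltings' theorem, surjectivity of `Hom_K(E, E') ⊗ ℤ_ℓ → Hom_{Γ_K}(T_ℓ E, T_ℓ E')`**
(elliptic-curve case of hodge.S27, untagged): for elliptic curves `E, E'` over a number field `K`
and a prime `ℓ`, every `ℤ_ℓ`-linear `Γ_K`-equivariant map `T_ℓ E → T_ℓ E'` lies in the
`ℤ_ℓ`-span of the maps `T_ℓ φ`, `φ : E → E'` an isogeny over `K` (i.e. in the image of
`Hom_K(E, E') ⊗ ℤ_ℓ`). Together with `linearIndependent_tateModule_map_of_numberField` this is
the isomorphism `Hom_K(E, E') ⊗ ℤ_ℓ ≅ Hom_{Γ_K}(T_ℓ E, T_ℓ E')`. Faltings, Invent. Math. 73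
(1983), Satz 4; Silverman, *AEC*, III.7.7(c). [cite: Faltings1983Endlichkeit, Satz 4] -/
def mem_span_range_tateModule_map_of_equivariant : Prop :=
  ∀ [NumberField K] [W.IsElliptic] [W'.IsElliptic] (f : W.tateModule ℓ →ₗ[ℤ_[ℓ]] W'.tateModule ℓ),
    (∀ (σ : Field.absoluteGaloisGroup K) (x : W.tateModule ℓ), f (σ • x) = σ • f x) →
    f ∈ Submodule.span ℤ_[ℓ]
      (Set.range fun φ : Isogeny W W' ↦ Literature.NumberTheory.EllipticCurves.TateModule.map ℓ φ.toAddMonoidHom)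

/-- **Faltings' theorem, `End` form** (elliptic-curve case of hodge.S27, untagged): for an
elliptic curve `E` over a number field `K` and a prime `ℓ`, a `ℤ_ℓ`-linear endomorphism of
`T_ℓ E` lies in the `ℤ_ℓ`-span of the image of `End_K(E)` (`tateEndRingHom`) if and only if it
commutes with `Γ_K`; i.e. `End_K(E) ⊗ ℤ_ℓ → End_{Γ_K}(T_ℓ E)` is surjective (its injectivity is
`linearIndependent_tateModule_map_of_numberField`). The forward implication is the elementary
`smul_of_mem_span_range_tateEndRingHom`. Faltings, Invent. Math. 73 (1983), Satz 4;
Silverman, *AEC*, III.7.7(b). [cite: Faltings1983Endlichkeit, Satz 4] -/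
def mem_span_range_tateEndRingHom_iff : Prop :=
  ∀ [NumberField K] [W.IsElliptic] (g : Module.End ℤ_[ℓ] (W.tateModule ℓ)),
    g ∈ Submodule.span ℤ_[ℓ] (Set.range (tateEndRingHom W ℓ)) ↔
      ∀ (σ : Field.absoluteGaloisGroup K) (x : W.tateModule ℓ), g (σ • x) = σ • g x

/-- **Faltings' isogeny theorem**, elliptic-curve case (corollary of the untagged special case
of hodge.S27): two elliptic curves `E, E'` over a number field `K` are isogenous over `K` if and
only if there is a non-zero `ℤ_ℓ`-linear, `Γ_K`-equivariant map `T_ℓ E → T_ℓ E'`. The forward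
direction is `T_ℓ` of an isogeny (non-zero by `linearIndependent_tateModule_map`, equivariant by
`tateModule_map_smul`); the converse follows from `mem_span_range_tateModule_map_of_equivariant`.
Faltings, Invent. Math. 73 (1983), Satz 4 and Korollar 2; Silverman, *AEC*, III.7.7(c).
[cite: Faltings1983Endlichkeit, Korollar 2] -/
def isIsogenous_iff_exists_tateModule_hom_ne_zero : Prop :=
  ∀ [NumberField K] [W.IsElliptic] [W'.IsElliptic],
    W.IsIsogenous W' ↔
      ∃ f : W.tateModule ℓ →ₗ[ℤ_[ℓ]] W'.tateModule ℓ,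
        f ≠ 0 ∧ ∀ (σ : Field.absoluteGaloisGroup K) (x : W.tateModule ℓ), f (σ • x) = σ • f x

/-- **Semisimplicity of the rational Tate module** (Faltings; elliptic-curve case of hodge.S27,
untagged): for an elliptic curve `E` over a number field `K` and a prime `ℓ`, the `ℚ_ℓ`-linear
Galois representation `V_ℓ E = ℚ_ℓ ⊗ T_ℓ E` of `Γ_K` is semisimple, i.e. every `Γ_K`-stable
`ℚ_ℓ`-subspace has a `Γ_K`-stable complement (Mathlib `Representation.IsSemisimpleRepresentation`).
Faltings, Invent. Math. 73 (1983), Satz 3; for elliptic curves this also follows from Serre,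
*Abelian ℓ-adic representations* (1968), IV.2.2 (non-CM) and II.2.5 (CM).
[cite: Faltings1983Endlichkeit, Satz 3] -/
def isSemisimpleRepresentation_rationalGaloisRepTate : Prop :=
  ∀ [NumberField K] [W.IsElliptic], (W.rationalGaloisRepTate ℓ).IsSemisimpleRepresentation

end NumberField

/-! ## Tate's theorems for elliptic curves over finite fields -/

section FiniteField

/- Hypothesis instances `[Finite K] [W.IsElliptic] [W'.IsElliptic]` are quantified in each fact's
body (see the module docstring, Design choices). -/
variable {K : Type u} [Field K] (W W' : WeierstrassCurve K) (ℓ : ℕ) [Fact ℓ.Prime]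

/-- **Tate's theorem, surjectivity of `Hom_k(E, E') ⊗ ℤ_ℓ → Hom_{Γ_k}(T_ℓ E, T_ℓ E')`** over a
finite field `k`, for a prime `ℓ ≠ char k` (elliptic-curve case of hodge.S27, untagged): every
`ℤ_ℓ`-linear `Γ_k`-equivariant map `T_ℓ E → T_ℓ E'` lies in the `ℤ_ℓ`-span of the maps `T_ℓ φ`,
`φ : E → E'` an isogeny over `k`. The hypothesis `ℓ ≠ char k` is essential (for `ℓ = p` the
module `T_p E` has rank `≤ 1` and the statement fails). Together with
`linearIndependent_tateModule_map` this is `Hom_k(E, E') ⊗ ℤ_ℓ ≅ Hom_{Γ_k}(T_ℓ E, T_ℓ E')`.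
Tate, Invent. Math. 2 (1966), Main Theorem; Silverman, *AEC*, III.7.7(a).
[cite: Tate1966Endomorphisms, Main Theorem] -/
def mem_span_range_tateModule_map_of_equivariant_of_finite : Prop :=
  ∀ [Finite K] [W.IsElliptic] [W'.IsElliptic], (ℓ : K) ≠ 0 →
    ∀ (f : W.tateModule ℓ →ₗ[ℤ_[ℓ]] W'.tateModule ℓ),
    (∀ (σ : Field.absoluteGaloisGroup K) (x : W.tateModule ℓ), f (σ • x) = σ • f x) →
    f ∈ Submodule.span ℤ_[ℓ]
      (Set.range fun φ : Isogeny W W' ↦ Literature.NumberTheory.EllipticCurves.TateModule.map ℓ φ.toAddMonoidHom)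

/-- **Tate's theorem, `End` form** over a finite field `k`, for a prime `ℓ ≠ char k`
(elliptic-curve case of hodge.S27, untagged): a `ℤ_ℓ`-linear endomorphism of `T_ℓ E` lies in the
`ℤ_ℓ`-span of the image of `End_k(E)` if and only if it commutes with `Γ_k`, i.e.
`End_k(E) ⊗ ℤ_ℓ → End_{Γ_k}(T_ℓ E)` is surjective. Tate, Invent. Math. 2 (1966), Main Theorem;
Silverman, *AEC*, III.7.7(a). [cite: Tate1966Endomorphisms, Main Theorem] -/
def mem_span_range_tateEndRingHom_iff_of_finite : Prop :=
  ∀ [Finite K] [W.IsElliptic], (ℓ : K) ≠ 0 → ∀ (g : Module.End ℤ_[ℓ] (W.tateModule ℓ)),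
    g ∈ Submodule.span ℤ_[ℓ] (Set.range (tateEndRingHom W ℓ)) ↔
      ∀ (σ : Field.absoluteGaloisGroup K) (x : W.tateModule ℓ), g (σ • x) = σ • g x

/-- **Semisimplicity of `V_ℓ E` over a finite field** `k`, for any prime `ℓ`
(elliptic-curve case of hodge.S27, untagged): the `ℚ_ℓ`-linear representation of `Γ_k` on
`V_ℓ E` is semisimple (Frobenius acts semisimply on `V_ℓ E`). No hypothesis `ℓ ≠ char k` is
needed: for `ℓ = char k` the space `V_ℓ E` has dimension `≤ 1` and is trivially semisimple.
Tate, Invent. Math. 2 (1966), Main Theorem and §2, Theorem 2(a); Silverman, *AEC*, V.2.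
[cite: Tate1966Endomorphisms, Thm. 2(a)] -/
def isSemisimpleRepresentation_rationalGaloisRepTate_of_finite : Prop :=
  ∀ [Finite K] [W.IsElliptic], (W.rationalGaloisRepTate ℓ).IsSemisimpleRepresentation

/-- **Tate's isogeny theorem**, point-count form (corollary of the untagged special case of
hodge.S27): two elliptic curves `E, E'` over a finite field `k` are isogenous over `k` if and
only if they have the same number of `k`-rational points, `#E(k) = #E'(k)` (equivalently the same
trace of Frobenius, or the same zeta function). Here `E(k)` is Mathlib's type of nonsingular
affine points together with `O`, `W.toAffine.Point`, which is finite for `k` finite (so that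
`Nat.card` is the honest cardinality). Tate, Invent. Math. 2 (1966), Theorem 1(c);
Silverman, *AEC*, V.2 and exercise 5.4. [cite: Tate1966Endomorphisms, Thm. 1(c)] -/
def isIsogenous_iff_card_point_eq : Prop :=
  ∀ [Finite K] [W.IsElliptic] [W'.IsElliptic],
    W.IsIsogenous W' ↔ Nat.card W.toAffine.Point = Nat.card W'.toAffine.Point

end FiniteField

/-! ## Tate's isogeny theorem, Tate-module form: the corrected statement -/

section FiniteFieldCorrected

variable {K : Type u} [Field K] (W W' : WeierstrassCurve K) (ℓ : ℕ) [Fact ℓ.Prime]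

/-- **Tate's isogeny theorem** over a finite field `k`, Tate-homomorphism form, for a prime
`ℓ ≠ char k` (corollary of the untagged special case of hodge.S27): if `(ℓ : k) ≠ 0` then two
elliptic curves `E, E'` over `k` are isogenous over `k` iff there is a non-zero `ℤ_ℓ`-linear
`Γ_k`-equivariant map `T_ℓ E → T_ℓ E'`. This is a corollary of Tate's Main Theorem
`Hom_k(E, E') ⊗ ℤ_ℓ ≅ Hom_{Γ_k}(T_ℓ E, T_ℓ E')` (a non-zero element on the right comes from a
non-zero element of `Hom_k(E, E')`, i.e. from an isogeny; the deduction is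
`isIsogenous_iff_exists_tateModule_hom_ne_zero_of_finite_of_tate` in the sibling
`FaltingsECIsogenyProofs`). The body is `(ℓ : K) ≠ 0 → (W.IsIsogenous W' ↔ ∃ f, …)`, vacuous for
`ℓ = char k`; this is the corrected form of the deprecated, mis-parenthesised record
`isIsogenous_iff_exists_tateModule_hom_ne_zero_of_finite` (final section), which it replaces.
Tate, Invent. Math. 2 (1966), Main Theorem and §3, Theorem 1; Silverman, *AEC*, III.7.7(a) and
Exercise 5.4(b). [cite: Tate1966Endomorphisms, Main Theorem and Thm. 1(b)] -/
def isIsogenous_of_finite_iff_exists_tateModule_hom_ne_zero : Prop :=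
  ∀ [Finite K] [W.IsElliptic] [W'.IsElliptic], (ℓ : K) ≠ 0 →
    (W.IsIsogenous W' ↔
      ∃ f : W.tateModule ℓ →ₗ[ℤ_[ℓ]] W'.tateModule ℓ,
        f ≠ 0 ∧ ∀ (σ : Field.absoluteGaloisGroup K) (x : W.tateModule ℓ), f (σ • x) = σ • f x)

variable {W W' ℓ}

/-- Unfolding lemma for `isIsogenous_of_finite_iff_exists_tateModule_hom_ne_zero` (`Iff.rfl`):
the fact is literally `(ℓ : K) ≠ 0 → (W.IsIsogenous W' ↔ ∃ f ≠ 0, Γ_k-equivariant)` under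
`[Finite K] [W.IsElliptic] [W'.IsElliptic]`; given `h : isIsogenous_of_finite_iff_… W W' ℓ` and
`hℓ : (ℓ : K) ≠ 0`, the equivalence is `h hℓ`. [folklore] -/
theorem isIsogenous_of_finite_iff_exists_tateModule_hom_ne_zero_iff :
    isIsogenous_of_finite_iff_exists_tateModule_hom_ne_zero W W' ℓ ↔
      ∀ [Finite K] [W.IsElliptic] [W'.IsElliptic], (ℓ : K) ≠ 0 →
        (W.IsIsogenous W' ↔
          ∃ f : W.tateModule ℓ →ₗ[ℤ_[ℓ]] W'.tateModule ℓ,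
            f ≠ 0 ∧ ∀ (σ : Field.absoluteGaloisGroup K) (x : W.tateModule ℓ),
              f (σ • x) = σ • f x) :=
  Iff.rfl

end FiniteFieldCorrected

/-! ## Deprecated record (verdict clean-up of 2026-08-15)

Mis-stated (precedence of `→` over `↔`) and refuted as written (`k = 𝔽₃`, `E = E' : y² = x³ - x`,
`ℓ = 3`: `SupersingularF3.not_isIsogenous_iff_exists_tateModule_hom_ne_zero_of_finite` in
`Literature.AlgebraicGeometry.Motives.FaltingsECIsogenyFiniteProofs`, which must keep naming the
constant); kept verbatim (D-0014) but deprecated in favour of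
`isIsogenous_of_finite_iff_exists_tateModule_hom_ne_zero`. No `…_holds` can exist. -/

section Deprecated

variable {K : Type u} [Field K] (W W' : WeierstrassCurve K) (ℓ : ℕ) [Fact ℓ.Prime]

/-- **DEPRECATED (2026-08-15) — mis-stated and refuted as written; use
`isIsogenous_of_finite_iff_exists_tateModule_hom_ne_zero`.** The body
`(ℓ : K) ≠ 0 → W.IsIsogenous W' ↔ ∃ f, …` parses as `((ℓ : K) ≠ 0 → W.IsIsogenous W') ↔ ∃ f, …`
(`→` binds more tightly than `↔`), which is false for `ℓ = char k` (supersingular `E`,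
`T_p E = 0`): refuted by
`Literature.AlgebraicGeometry.Motives.SupersingularF3.not_isIsogenous_iff_exists_tateModule_hom_ne_zero_of_finite`
(module `Literature.AlgebraicGeometry.Motives.FaltingsECIsogenyFiniteProofs`); for `(ℓ : K) ≠ 0` it
agrees with the corrected fact (`…_of_misstated` below: old ⇒ corrected at every `ℓ`). Intended
content, now carried correctly parenthesised by the replacement: Tate's isogeny theorem over a
finite field `k`, Tate-homomorphism form, `ℓ ≠ char k` — `E ~_k E'` iff there is a non-zero
`ℤ_ℓ`-linear `Γ_k`-equivariant `T_ℓ E → T_ℓ E'`; Tate, Invent. Math. 2 (1966), Main Theorem and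
Theorem 1; Silverman, *AEC*, III.7.7(a). The tag records the intended source only.
[cite: Tate1966Endomorphisms, Thm. 1(b) — intended source of a mis-parenthesised rendering; see the deprecation note] -/
@[deprecated isIsogenous_of_finite_iff_exists_tateModule_hom_ne_zero (since := "2026-08-15")]
def isIsogenous_iff_exists_tateModule_hom_ne_zero_of_finite : Prop :=
  ∀ [Finite K] [W.IsElliptic] [W'.IsElliptic], (ℓ : K) ≠ 0 →
    W.IsIsogenous W' ↔
      ∃ f : W.tateModule ℓ →ₗ[ℤ_[ℓ]] W'.tateModule ℓ,
        f ≠ 0 ∧ ∀ (σ : Field.absoluteGaloisGroup K) (x : W.tateModule ℓ), f (σ • x) = σ • f x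

variable {W W' ℓ}

-- `linter.deprecated` is off for the next declaration only: it is the machine-checked bridge from the
-- deprecated record to its correction and must name the deprecated constant (verdict clean-up 2026-08-15).
set_option linter.deprecated false in
/-- The deprecated, mis-parenthesised record `isIsogenous_iff_exists_tateModule_hom_ne_zero_of_finite`
implies the corrected fact `isIsogenous_of_finite_iff_exists_tateModule_hom_ne_zero` at every
prime `ℓ` (for `(ℓ : K) ≠ 0` the two are equivalent; for `ℓ = char k` the corrected statement is
vacuous). Bookkeeping only: the hypothesis is refuted at some parameters
(`SupersingularF3.not_isIsogenous_iff_exists_tateModule_hom_ne_zero_of_finite`). [folklore] -/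
theorem isIsogenous_of_finite_iff_exists_tateModule_hom_ne_zero_of_misstated
    (h : isIsogenous_iff_exists_tateModule_hom_ne_zero_of_finite W W' ℓ) :
    isIsogenous_of_finite_iff_exists_tateModule_hom_ne_zero W W' ℓ := by
  intro _ _ _ hℓ
  have h' := @h _ _ _
  exact ⟨fun hiso ↦ h'.mp fun _ ↦ hiso, fun hf ↦ h'.mpr hf hℓ⟩

end Deprecated

end Literature.AlgebraicGeometry.Motives
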